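/-
Origin: expansion seat `prover-pub-hodgecm-mc-binder-1-g2-0`, handover #2 2026-08-18T20:24Z md5 273ade6792799a493ce3ec12fda81a43 (NEW, 370 l.; install after #1; rewrites import McB1g2.MeetBridges -> HodgeCM.Model.Binders.MeetBridges x1; also imports PKG HodgeCM.PerL34.SeesawDictionary, HodgeCM.PerL34.QautDictionary (run 22, unchanged); 14 decls, #print axioms ⊆ trio 14/14 (scratch lean/McB1g2/AxiomsMBS.scratch.lean, NOT handed); audited names: HodgeCM.Universe.ThetaM (`HOME/mc/pub-hodgecm-mc-binder-1/lean/McB1g2/MeetBridgesShells.lean`, md5 273ade67, 370 lines);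
landed by the packager successor (mc-unitary-1-g3, gen-8 kit) in gate run 32 as `HodgeCM/Model/Binders/MeetBridgesShells.lean` (import ^import McB1g2\.MeetBridges[ \t]*$→import HodgeCM.Model.Binders.MeetBridges ×1).
-/
/-
Origin: speedrun cell pub-hodgecm, MODEL-CONSTRUCTION sub-cell, unit pub-hodgecm-mc-binder-1-g2 (BINDER PROVER hbr/hQ/hch,
gen 2; node B2-meet = rows hbr/hQ under the ₁₀ end state), seat prover-pub-hodgecm-mc-binder-1-g2-0, 2026-08-18.
Target in PKG: HodgeCM/Model/Binders/MeetBridgesShells.lean (NEW additive leaf, after HodgeCM/Model/Binders/MeetBridges.lean;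
nothing landed imports it).  Staged import `McB1g2.MeetBridges` ↦ `HodgeCM.Model.Binders.MeetBridges` (packager rewrites ×1).
KERNEL ONLY: 0 records asserted, 0 cited hypotheses, MODEL-N 0; `#print axioms` of every theorem = the standard trio.
-/
import Summits.HodgeConjecture.HodgeCM.Model.Binders.MeetBridges
import Summits.HodgeConjecture.HodgeCM.PerL34.SeesawDictionary
import Summits.HodgeConjecture.HodgeCM.PerL34.QautDictionary

/-!
# B2-meet, continued — the E0 SHELLS re-targeted: `SeesawBridge` / `QautBridge` minus their support-sensitive field

`MeetBridges.lean` typed the abstract function-level records `Gen12FunBridge` / `Real34FunBridge` for C5′ / C6′.  This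
file shows what the binders hbr / hQ KEEP of their E0 bridges on the ₁₀ path and what they EXCHANGE:

* hbr: `SeesawDictionary.SeesawBridge T V c D k l` (pv11, run 22) keeps its lattice shell `DS`, the six N17 hypotheses,
  `toHG`, `Adm₁/₂`, `integrable₁/₂` and the dictionary field `ϑ_period` VERBATIM; its field `Λ_wedge`
  (`T.Λ Γ ω ω' = toHG (u₁¹u₂² − u₁²u₂¹)`, an EQUALITY in `L²([G_U])`, support-sensitive) is exchanged for
  **`Λ_proj`**: `⟪T.Λ Γ ω ω', toHG (u₁¹u₂² − u₁²u₂¹)⟫ = a · ⟪T.Λ Γ ω ω', T.Λ Γ ω ω'⟫`, `a ≠ 0` — the piece-projection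
  / unfolding statement.  Record `SeesawFunBridge`; `gen12MeetAt_of_seesawFunBridge` (the join is the landed kernel
  seesaw identity `SeesawWedge.genIdentity_core`, node N17, exactly as in `N19w_genIdentity_of_bridge`);
  `SeesawFunBridge.ofSeesawBridge` (E0 ⇒ ₁₀, `a = 1`).
* hQ: `QautDictionary.QautBridge T V c D k l` (pv02-g2, run 22) keeps its archimedean algebra shell (`K, μ, C, σ, ρ, k₀,
  ξ`), `toHG`, `Forms₁/₂`, `isForm₁/₂`, `P`, `dense`, `decomp` (now for EVERY character: all-characters cut);
  its field `wedge_mem` (`toHG (u ∧ v) ∈ T.wedgeSet`, support-sensitive) is DROPPED from the analytic core — record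
  `QautCore` — whose output is **Lemma 3.5 (34) in FUNCTION form**, KERNEL modulo the shell:
  `QautCore.ϑ_mem_closure_span : D.ϑ χ Φ ∈ closure (span wset)`, `wset = {toHG (u ∧ v)}` (the `U(1)`-weight count
  `Qaut.pr_mul_eq_zero_of_weights` / `pr_mul_mem_span_wedge` of the landed `QautWedge`, PerL ll. 367–372, then
  density + continuity `S12Wedges.continuous_ϑ`, ll. 358–359); the met-level statement is supplied separately as the
  `meet` field of `Real34FunBridge.ofQautCore`; `real34MeetAt_of_qautCore`; `QautCore.ofQautBridge` (E0 ⇒ core when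
  every character is allowed).
Labels of the kept fields are those of the two source files' docstrings (unchanged); nothing is cited here.
-/

set_option autoImplicit false

noncomputable section

open scoped InnerProductSpace
open MeasureTheory Matrix
open HodgeCM.Prior.Perl34File
open HodgeCM.PerL34 HodgeCM.PerL34.Seesaw HodgeCM.PerL34.Qaut

namespace HodgeCM

namespace Universe

namespace ThetaModel

variable {U : Universe} (T : U.ThetaModel)
variable {L : CMField} {ι₁ : L →+* ℂ} (V : HermSpace3 L ι₁) (c : SeesawCtx L)
variable (D : Perl34.TorusData (T.core V c)) (k l : Fin 4)

/-! ## 1. hbr — the seesaw shell with `Λ_wedge` ↦ `Λ_proj` -/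

/-- **The (12) seesaw bridge, ₁₀ form** for the side `(k, l)` with torus data `D`: `SeesawDictionary.SeesawBridge`
with the equality field `Λ_wedge` replaced by the PAIRING field `Λ_proj` (the model's wedge-function of two theta
one-forms pairs with the GLOBAL wedge-scalar function of their admissible theta-lift components as a non-zero multiple
of its own square norm).  Every other field verbatim (labels: `SeesawDictionary` module docstring). -/
structure SeesawFunBridge where
  /-- SETUP (D4′): the lattice shell of `Seesaw.lean` -/
  DS : ThetaSeesawData
  [instS : AddCommGroup DS.S]
  [instA₁ : MeasurableSpace DS.A₁]
  [instA₂ : MeasurableSpace DS.A₂]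
  /-- Haar probability measures of `[U(W₁)]`, `[U(W₂)]` -/
  ν₁ : Measure DS.A₁
  ν₂ : Measure DS.A₂
  [sf₁ : SFinite ν₁]
  [sf₂ : SFinite ν₂]
  /-- N17 hypotheses (as in the landed `SeesawWedge.genIdentity_core`) -/
  omegaSub : DS.OmegaSub
  evSub : DS.EvSub
  evalTmul : DS.EvalTmul
  restrictTmul : DS.RestrictTmul
  absSummable₁ : DS.AbsSummable₁
  absSummable₂ : DS.AbsSummable₂
  /-- D5: realisation of a function on `G_U(𝔸)` as an element of `L²([G_U])` -/
  toHG : (DS.G → ℂ) → T.HG L ι₁ V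
  /-- D1/D5: admissible shell data of types `k` on `W₁`, `l` on `W₂` -/
  Adm₁ : (DS.A₁ → ℂ) → DS.S₁ → Prop
  Adm₂ : (DS.A₂ → ℂ) → DS.S₂ → Prop
  /-- PerL l. 335: integrability on the compact `[U(W_j)]` -/
  integrable₁ : ∀ (χ₁ : DS.A₁ → ℂ) (φ : DS.S₁), Adm₁ χ₁ φ → ∀ g : DS.G,
    Integrable (fun u => DS.thetaKernel₁ φ g u * χ₁ u) ν₁
  integrable₂ : ∀ (χ₂ : DS.A₂ → ℂ) (φ : DS.S₂), Adm₂ χ₂ φ → ∀ g : DS.G,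
    Integrable (fun u => DS.thetaKernel₂ φ g u * χ₂ u) ν₂
  /-- DICTIONARY D2/D5, ₁₀ FORM (piece projection / unfolding): theta one-forms of types `k`, `l` have admissible
  theta-lift components `u^i_j = θ(φ^i_j, χ′_j)` and `⟪T.Λ Γ u₁ u₂, toHG (u₁¹u₂² − u₁²u₂¹)⟫ = a · ⟪T.Λ Γ u₁ u₂, T.Λ Γ u₁ u₂⟫`
  for some `a ≠ 0` -/
  Λ_proj : ∀ (Γ : Level V), ∀ ω ∈ T.Theta V c k Γ, ∀ ω' ∈ T.Theta V c l Γ,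
    ∃ (χ₁ : DS.A₁ → ℂ) (χ₂ : DS.A₂ → ℂ) (φ₁₁ φ₁₂ : DS.S₁) (φ₂₁ φ₂₂ : DS.S₂),
      Adm₁ χ₁ φ₁₁ ∧ Adm₁ χ₁ φ₁₂ ∧ Adm₂ χ₂ φ₂₁ ∧ Adm₂ χ₂ φ₂₂ ∧
      ∃ a : ℂ, a ≠ 0 ∧
        ⟪T.Λ Γ ω ω', toHG (DS.wedgeScalar (DS.thetaLift₁ ν₁ χ₁ φ₁₁) (DS.thetaLift₁ ν₁ χ₁ φ₁₂)
          (DS.thetaLift₂ ν₂ χ₂ φ₂₁) (DS.thetaLift₂ ν₂ χ₂ φ₂₂))⟫_ℂ = a * ⟪T.Λ Γ ω ω', T.Λ Γ ω ω'⟫_ℂ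
  /-- DICTIONARY D5 (`pr_κ`) + D4 (`ϑ`), verbatim: the torus period of `Φ′ = φ₁₁⊗φ₂₂ − φ₁₂⊗φ₂₁` is a model generator -/
  ϑ_period : ∀ (χ₁ : DS.A₁ → ℂ) (χ₂ : DS.A₂ → ℂ) (φ₁₁ φ₁₂ : DS.S₁) (φ₂₁ φ₂₂ : DS.S₂),
    Adm₁ χ₁ φ₁₁ → Adm₁ χ₁ φ₁₂ → Adm₂ χ₂ φ₂₁ → Adm₂ χ₂ φ₂₂ →
      ∃ χ : D.X, ∃ Φ, D.ϑ χ Φ =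
        toHG (DS.thetaPeriod ν₁ ν₂ χ₁ χ₂ (DS.tmul φ₁₁ φ₂₂ - DS.tmul φ₁₂ φ₂₁))

attribute [instance] SeesawFunBridge.instS SeesawFunBridge.instA₁ SeesawFunBridge.instA₂ SeesawFunBridge.sf₁
  SeesawFunBridge.sf₂

variable {T V c D k l}

/-- **The ₁₀ (12) identity-with-pairing from the seesaw shell** (join = the landed kernel seesaw identity
`SeesawWedge.genIdentity_core`, node N17): for theta one-forms `ω ∈ Θ_k(Γ)`, `ω' ∈ Θ_l(Γ)` there is a model
generator `D.ϑ χ Φ` with `⟪T.Λ Γ ω ω', D.ϑ χ Φ⟫ = a · ⟪T.Λ Γ ω ω', T.Λ Γ ω ω'⟫`, `a ≠ 0`. -/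
theorem SeesawFunBridge.exists_ϑ_inner_eq (B : SeesawFunBridge T V c D k l) (Γ : Level V)
    {ω ω' : U.CohC (U.pms L ι₁ V Γ) 1} (hω : ω ∈ T.Theta V c k Γ) (hω' : ω' ∈ T.Theta V c l Γ) :
    ∃ (χ : D.X) (Φ : T.SK V c) (a : ℂ), a ≠ 0 ∧
      ⟪T.Λ Γ ω ω', D.ϑ χ Φ⟫_ℂ = a * ⟪T.Λ Γ ω ω', T.Λ Γ ω ω'⟫_ℂ := by
  obtain ⟨χ₁, χ₂, φ₁₁, φ₁₂, φ₂₁, φ₂₂, h₁₁, h₁₂, h₂₁, h₂₂, a, ha, hΛ⟩ := B.Λ_proj Γ ω hω ω' hω'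
  obtain ⟨χ, Φ, hϑ⟩ := B.ϑ_period χ₁ χ₂ φ₁₁ φ₁₂ φ₂₁ φ₂₂ h₁₁ h₁₂ h₂₁ h₂₂
  refine ⟨χ, Φ, a, ha, ?_⟩
  rw [hϑ, ← hΛ]
  congr 2
  funext g
  exact (B.DS.genIdentity_core B.ν₁ B.ν₂ B.omegaSub B.evSub B.evalTmul B.restrictTmul B.absSummable₁
    B.absSummable₂ χ₁ χ₂ φ₁₁ φ₁₂ φ₂₁ φ₂₂ g (B.integrable₁ χ₁ φ₁₁ h₁₁ g) (B.integrable₁ χ₁ φ₁₂ h₁₂ g)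
    (B.integrable₂ χ₂ φ₂₁ h₂₁ g) (B.integrable₂ χ₂ φ₂₂ h₂₂ g)).symm

/-- **C5′ from the (12) seesaw shell, ₁₀ form** (row hbr): a bridge for the (12) side at `(V, c)` gives
`Gen12MeetAt V c`. -/
theorem gen12MeetAt_of_seesawFunBridge (B : SeesawFunBridge T V c (T.t12 V c) 0 1) : T.Gen12MeetAt V c := by
  intro Γ ω₁ ω₂ h₁ h₂ hne
  obtain ⟨χ, Φ, a, ha, h⟩ := B.exists_ϑ_inner_eq Γ h₁ h₂
  exact ⟨χ, Φ, by rw [h]; exact mul_ne_zero ha (inner_self_ne_zero.mpr hne)⟩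

/-- The abstract function-level record `Gen12FunBridge` from the shell: `wf` := the generator `D.ϑ χ Φ` chosen by
`exists_ϑ_inner_eq` on theta one-forms (and `0` elsewhere), so that `wf_gen` is by construction and `proj` is the
pairing identity.  Stated through `Nonempty` (the choice stays inside `Prop`). -/
theorem nonempty_gen12FunBridge_of_seesawFunBridge (B : SeesawFunBridge T V c (T.t12 V c) 0 1) :
    Nonempty (T.Gen12FunBridge V c) := by
  classical
  refine ⟨{ wf := fun Γ ω₁ ω₂ =>
              if h : ω₁ ∈ T.Theta V c 0 Γ ∧ ω₂ ∈ T.Theta V c 1 Γ then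
                (T.t12 V c).ϑ (B.exists_ϑ_inner_eq Γ h.1 h.2).choose
                  (B.exists_ϑ_inner_eq Γ h.1 h.2).choose_spec.choose
              else 0,
            wf_gen := ?_, proj := ?_ }⟩
  · intro Γ ω₁ ω₂ h₁ h₂
    refine ⟨(B.exists_ϑ_inner_eq Γ h₁ h₂).choose, (B.exists_ϑ_inner_eq Γ h₁ h₂).choose_spec.choose, ?_⟩
    simp only [dif_pos (And.intro h₁ h₂)]
  · intro Γ ω₁ ω₂ h₁ h₂
    obtain ⟨a, ha, h⟩ := (B.exists_ϑ_inner_eq Γ h₁ h₂).choose_spec.choose_spec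
    refine ⟨a, ha, ?_⟩
    simp only [dif_pos (And.intro h₁ h₂)]
    exact h

/-- **E0 ⇒ ₁₀ for hbr**: the E0 bridge (equality `Λ_wedge`) gives the ₁₀ bridge with `a = 1`. -/
def SeesawFunBridge.ofSeesawBridge (B : SeesawDictionary.SeesawBridge T V c D k l) :
    SeesawFunBridge T V c D k l where
  DS := B.DS
  ν₁ := B.ν₁
  ν₂ := B.ν₂
  omegaSub := B.omegaSub
  evSub := B.evSub
  evalTmul := B.evalTmul
  restrictTmul := B.restrictTmul
  absSummable₁ := B.absSummable₁
  absSummable₂ := B.absSummable₂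
  toHG := B.toHG
  Adm₁ := B.Adm₁
  Adm₂ := B.Adm₂
  integrable₁ := B.integrable₁
  integrable₂ := B.integrable₂
  Λ_proj Γ ω hω ω' hω' := by
    obtain ⟨χ₁, χ₂, φ₁₁, φ₁₂, φ₂₁, φ₂₂, h₁₁, h₁₂, h₂₁, h₂₂, hΛ⟩ := B.Λ_wedge Γ ω hω ω' hω'
    exact ⟨χ₁, χ₂, φ₁₁, φ₁₂, φ₂₁, φ₂₂, h₁₁, h₁₂, h₂₁, h₂₂, 1, one_ne_zero, by rw [← hΛ, one_mul]⟩
  ϑ_period := B.ϑ_period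

/-! ## 2. hQ — the Qaut shell without `wedge_mem`: Lemma 3.5 (34) in FUNCTION form -/

variable (T V c D)

/-- **The Qaut analytic core** with torus data `D`: `QautDictionary.QautBridge` WITHOUT its support-sensitive
dictionary field `wedge_mem`, and with `decomp` for EVERY character (all-characters cut).  Labels of the fields: the
`QautDictionary` module docstring. -/
structure QautCore where
  /-- SHELL (D5): `K_{ι₁} ≅ U(2) × U(1)` (or `K_∞`) -/
  K : Type
  [instK₁ : Group K]
  [instK₂ : TopologicalSpace K]
  [instK₃ : IsTopologicalGroup K]
  [instK₄ : MeasurableSpace K]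
  [instK₅ : BorelSpace K]
  [instK₆ : CompactSpace K]
  /-- its Haar probability measure -/
  μ : Measure K
  [instμ₁ : IsProbabilityMeasure μ]
  [instμ₂ : μ.IsMulLeftInvariant]
  [instμ₃ : μ.IsMulRightInvariant]
  /-- SHELL (D5): a commutative Banach algebra of bounded right-uniformly continuous functions on `[G_U]` -/
  C : Type
  [instC₁ : NormedCommRing C]
  [instC₂ : NormedAlgebra ℂ C]
  [instC₃ : CompleteSpace C]
  /-- right translation by `K`, strongly continuous -/
  σ : K →* (C →ₐ[ℂ] C)
  σ_cont : ∀ f : C, Continuous fun x => σ x f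
  /-- `ρ = 𝔭₊` in a weight basis -/
  ρ : K →* Matrix (Fin 2) (Fin 2) ℂ
  ρ_cont : Continuous fun x => ρ x
  ρ_det : ∀ x, IsUnit (ρ x).det
  ρ_diag : ∃ x s t, s ≠ t ∧ ρ x = !![s, 0; 0, t]
  ρ_antidiag : ∃ x a b, ρ x = !![0, a; b, 0]
  /-- the central `U(1)` element `k₀` acting on `𝔭₊` by the scalar `ξ` of infinite order -/
  k₀ : K
  ξ : ℂ
  ξ_ne_zero : ξ ≠ 0
  ξ_pow_ne_one : ∀ m : ℕ, 1 ≤ m → ξ ^ m ≠ 1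
  ρ_k₀ : ρ k₀ = ξ • (1 : Matrix (Fin 2) (Fin 2) ℂ)
  /-- DICTIONARY (D5): the `L²` class of a function of the shell -/
  toHG : C →ₗ[ℂ] T.HG L ι₁ V
  /-- DEFINITIONAL (D2/D5): holomorphic theta one-forms attached to `π_1[𝔭₊]`, `π_2[𝔭₊]`, as component maps -/
  Forms₁ : D.X → Set ((Fin 2 → ℂ) →ₗ[ℂ] C)
  Forms₂ : D.X → Set ((Fin 2 → ℂ) →ₗ[ℂ] C)
  isForm₁ : ∀ χ, ∀ u ∈ Forms₁ χ, IsForm ρ σ u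
  isForm₂ : ∀ χ, ∀ v ∈ Forms₂ χ, IsForm ρ σ v
  /-- D4 + PRINT (density of `K`-finite vectors): the dense subspace `pr_κ(𝒫) ⊆ 𝒮^κ` -/
  P : Set (T.SK V c)
  dense : Dense P
  /-- DICTIONARY ((eq:seesaw) on pure tensors; `K`-type transport; `K`-types of `J⁺`; `𝔭₊`-vectors are components of
  holomorphic one-forms) — the finite-sum decomposition of a generator, for EVERY character -/
  decomp : ∀ χ, ∀ Φ ∈ P, ∃ (n : ℕ) (f₁ f₂ : Fin n → C) (w₁ w₂ : Fin n → ℕ),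
    (∀ i, 1 ≤ w₁ i ∧ σ k₀ (f₁ i) = ξ ^ (w₁ i) • f₁ i ∧
      (w₁ i = 1 → f₁ i ∈ Submodule.span ℂ {f | ∃ u ∈ Forms₁ χ, ∃ x, f = u x})) ∧
    (∀ i, 1 ≤ w₂ i ∧ σ k₀ (f₂ i) = ξ ^ (w₂ i) • f₂ i ∧
      (w₂ i = 1 → f₂ i ∈ Submodule.span ℂ {f | ∃ v ∈ Forms₂ χ, ∃ y, f = v y})) ∧
    D.ϑ χ Φ = toHG (∑ i, pr μ ρ σ (f₁ i * f₂ i))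

attribute [instance] QautCore.instK₁ QautCore.instK₂ QautCore.instK₃ QautCore.instK₄ QautCore.instK₅
  QautCore.instK₆ QautCore.instμ₁ QautCore.instμ₂ QautCore.instμ₃ QautCore.instC₁ QautCore.instC₂
  QautCore.instC₃

namespace QautCore

variable {T V c D}
variable (B : QautCore T V c D)

/-- The GLOBAL (34)-wedge-functions of the shell: `toHG (u ∧ v)`, `u ∈ Forms₁ χ`, `v ∈ Forms₂ χ`, any `χ`. -/
def wset : Set (T.HG L ι₁ V) :=
  {x | ∃ χ : D.X, ∃ u ∈ B.Forms₁ χ, ∃ v ∈ B.Forms₂ χ, x = B.toHG (wedge u v)}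

/-- `det 𝔭₊(k₀) = ξ²`. -/
theorem det_ρ_k₀ : (B.ρ B.k₀).det = B.ξ ^ 2 := by
  rw [B.ρ_k₀, det_smul, det_one, mul_one, Fintype.card_fin]

/-- The `U(1)`-weight count (PerL ll. 368–370): `ξ^{n₁} ξ^{n₂} ≠ ξ² = det 𝔭₊(k₀)` unless `n₁ = n₂ = 1`. -/
theorem weights_ne_det {n₁ n₂ : ℕ} (h₁ : 1 ≤ n₁) (h₂ : 1 ≤ n₂) (h : ¬(n₁ = 1 ∧ n₂ = 1)) :
    B.ξ ^ n₁ * B.ξ ^ n₂ ≠ (B.ρ B.k₀).det := by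
  rw [B.det_ρ_k₀, ← pow_add]
  have h3 : 2 + 1 ≤ n₁ + n₂ := by omega
  obtain ⟨m, hm⟩ := Nat.exists_eq_add_of_le h3
  intro heq
  have h2ne : B.ξ ^ 2 ≠ 0 := pow_ne_zero _ B.ξ_ne_zero
  have hm' : n₁ + n₂ = 2 + (m + 1) := by omega
  rw [hm', pow_add] at heq
  have hone : B.ξ ^ (m + 1) = 1 := mul_left_cancel₀ h2ne (heq.trans (mul_one (B.ξ ^ 2)).symm)
  exact B.ξ_pow_ne_one (m + 1) (by omega) hone

/-- One term of the decomposition lies in the span of the wedges (PerL ll. 367–372; landed `QautWedge`). -/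
theorem pr_mul_mem (χ : D.X) {f₁ f₂ : B.C} {n₁ n₂ : ℕ} (h₁ : 1 ≤ n₁) (h₂ : 1 ≤ n₂)
    (e₁ : B.σ B.k₀ f₁ = B.ξ ^ n₁ • f₁) (e₂ : B.σ B.k₀ f₂ = B.ξ ^ n₂ • f₂)
    (s₁ : n₁ = 1 → f₁ ∈ Submodule.span ℂ {f | ∃ u ∈ B.Forms₁ χ, ∃ x, f = u x})
    (s₂ : n₂ = 1 → f₂ ∈ Submodule.span ℂ {f | ∃ v ∈ B.Forms₂ χ, ∃ y, f = v y}) :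
    pr B.μ B.ρ B.σ (f₁ * f₂) ∈ Submodule.span ℂ {g | ∃ u ∈ B.Forms₁ χ, ∃ v ∈ B.Forms₂ χ, g = wedge u v} := by
  by_cases h : n₁ = 1 ∧ n₂ = 1
  · exact pr_mul_mem_span_wedge B.ρ_cont B.ρ_det B.σ_cont B.ρ_diag B.ρ_antidiag (B.Forms₁ χ) (B.Forms₂ χ)
      (B.isForm₁ χ) (B.isForm₂ χ) (s₁ h.1) (s₂ h.2)
  · rw [pr_mul_eq_zero_of_weights B.ρ_det B.k₀ e₁ e₂ (B.weights_ne_det h₁ h₂ h)]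
    exact Submodule.zero_mem _

/-- `toHG` maps the span of the shell wedges into the span of `wset`. -/
theorem map_span_wedge_le (χ : D.X) :
    (Submodule.span ℂ {g | ∃ u ∈ B.Forms₁ χ, ∃ v ∈ B.Forms₂ χ, g = wedge u v}).map B.toHG ≤
      Submodule.span ℂ B.wset := by
  rw [Submodule.map_span, Submodule.span_le]
  rintro _ ⟨g, ⟨u, hu, v, hv, rfl⟩, rfl⟩
  exact Submodule.subset_span ⟨χ, u, hu, v, hv, rfl⟩

/-- On the dense subspace `P` a generator is a FINITE combination of global wedge-functions (PerL ll. 360–372). -/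
theorem ϑ_mem_span_of_mem (χ : D.X) {Φ : T.SK V c} (hΦ : Φ ∈ B.P) :
    D.ϑ χ Φ ∈ Submodule.span ℂ B.wset := by
  obtain ⟨n, f₁, f₂, w₁, w₂, hw₁, hw₂, hϑ⟩ := B.decomp χ Φ hΦ
  rw [hϑ]
  refine B.map_span_wedge_le χ (Submodule.mem_map.mpr ⟨_, ?_, rfl⟩)
  exact Submodule.sum_mem _ fun i _ =>
    B.pr_mul_mem χ (hw₁ i).1 (hw₂ i).1 (hw₁ i).2.1 (hw₂ i).2.1 (hw₁ i).2.2 (hw₂ i).2.2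

/-- **Lemma 3.5 (34) in FUNCTION form, KERNEL modulo the shell dictionary**: every generator `D.ϑ χ Φ` lies in the
closed span of the global wedge-functions `toHG (u ∧ v)` (density of `P` + continuity of `Φ ↦ ϑ_{T,χ}(Φ)`,
PerL ll. 358–359, `S12Wedges.continuous_ϑ`). -/
theorem ϑ_mem_closure_span (χ : D.X) (Φ : T.SK V c) :
    D.ϑ χ Φ ∈ (Submodule.span ℂ B.wset).topologicalClosure := by
  have hΦ : Φ ∈ closure B.P := by rw [B.dense.closure_eq]; exact Set.mem_univ Φ
  have h1 : D.ϑ χ Φ ∈ closure ((fun Ψ : T.SK V c => D.ϑ χ Ψ) '' B.P) :=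
    image_closure_subset_closure_image (continuous_ϑ T V c D χ) ⟨Φ, hΦ, rfl⟩
  rw [← SetLike.mem_coe, Submodule.topologicalClosure_coe]
  refine closure_mono ?_ h1
  rintro _ ⟨Ψ, hΨ, rfl⟩
  exact B.ϑ_mem_span_of_mem χ hΨ

/-- **E0 ⇒ core for hQ** when every character of the side is allowed (all-characters cut): a `QautBridge` gives a
`QautCore` (drop `wedge_mem`). -/
def ofQautBridge {k l : Fin 4} (B : QautDictionary.QautBridge T V c D k l) (hall : ∀ χ : D.X, D.allowed χ) :
    QautCore T V c D where
  K := B.K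
  μ := B.μ
  C := B.C
  σ := B.σ
  σ_cont := B.σ_cont
  ρ := B.ρ
  ρ_cont := B.ρ_cont
  ρ_det := B.ρ_det
  ρ_diag := B.ρ_diag
  ρ_antidiag := B.ρ_antidiag
  k₀ := B.k₀
  ξ := B.ξ
  ξ_ne_zero := B.ξ_ne_zero
  ξ_pow_ne_one := B.ξ_pow_ne_one
  ρ_k₀ := B.ρ_k₀
  toHG := B.toHG
  Forms₁ := B.Forms₁
  Forms₂ := B.Forms₂
  isForm₁ := B.isForm₁
  isForm₂ := B.isForm₂
  P := B.P
  dense := B.dense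
  decomp χ := B.decomp χ (hall χ)

end QautCore

variable {T V c D}

/-- **The ₁₀ (34) bridge from the Qaut core + a met-level statement on its global wedge-functions** (row hQ):
`gen_mem` is the kernel Lemma 3.5 (34) function form `QautCore.ϑ_mem_closure_span`. -/
def Real34FunBridge.ofQautCore (B : QautCore T V c (T.t34 V c))
    (meet : ∀ (Γ₁ : Level V) (ω₁ ω₂ : U.CohC (U.pms L ι₁ V Γ₁) 1),
      ω₁ ∈ U.Uiso Γ₁ c.K (c.Ψ 0) c.σ → ω₂ ∈ U.Uiso Γ₁ c.K (c.Ψ 1) c.σ →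
      ∀ P ∈ B.wset, ⟪T.Λ Γ₁ ω₁ ω₂, P⟫_ℂ ≠ 0 →
      ∃ (Γ : Level V) (ω : Fin 4 → U.CohC (U.pms L ι₁ V Γ) 1),
        (∀ i, ω i ∈ U.Uiso Γ c.K (c.Ψ i) c.σ) ∧ ⟪T.Λ Γ (ω 2) (ω 3), T.Λ Γ (ω 0) (ω 1)⟫_ℂ ≠ 0) :
    T.Real34FunBridge V c where
  wset := B.wset
  gen_mem := B.ϑ_mem_closure_span
  meet := meet

/-- **C6′ from the Qaut core and the met-level statement** (row hQ, ₁₀ form). -/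
theorem real34MeetAt_of_qautCore (B : QautCore T V c (T.t34 V c))
    (meet : ∀ (Γ₁ : Level V) (ω₁ ω₂ : U.CohC (U.pms L ι₁ V Γ₁) 1),
      ω₁ ∈ U.Uiso Γ₁ c.K (c.Ψ 0) c.σ → ω₂ ∈ U.Uiso Γ₁ c.K (c.Ψ 1) c.σ →
      ∀ P ∈ B.wset, ⟪T.Λ Γ₁ ω₁ ω₂, P⟫_ℂ ≠ 0 →
      ∃ (Γ : Level V) (ω : Fin 4 → U.CohC (U.pms L ι₁ V Γ) 1),
        (∀ i, ω i ∈ U.Uiso Γ c.K (c.Ψ i) c.σ) ∧ ⟪T.Λ Γ (ω 2) (ω 3), T.Λ Γ (ω 0) (ω 1)⟫_ℂ ≠ 0) :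
    T.Real34MeetAt V c :=
  T.real34MeetAt_of_funBridge (Real34FunBridge.ofQautCore B meet)

end ThetaModel

end Universe

end HodgeCM

end
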